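import Literature.AlgebraicGeometry.Motives.GeneratingSectionsOfLocallyAmplePieces
import Literature.AlgebraicGeometry.Motives.GeneratingSectionsAlongOpenImmersion
import Literature.AlgebraicGeometry.Motives.ProjectiveDescentNormProofs
import Literature.AlgebraicGeometry.Modules.LineBundleOfCocycleClass
import Literature.AlgebraicGeometry.ModuliOfAbelianVarieties.SiegelModuliFrameSubfunctor
import Literature.AlgebraicGeometry.Motives.GeneratingSectionsFrameIndependence
import HarnessLib
import Literature.AlgebraicGeometry.ModuliOfAbelianVarieties.SiegelModuliIntrinsicSections
import Literature.AlgebraicGeometry.ModuliOfAbelianVarieties.SiegelModuliUniversalFamilyQuasiProjective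
import Literature.AlgebraicGeometry.ModuliOfAbelianVarieties.SiegelModuliFrameSliceRepresents
import Literature.AlgebraicGeometry.AbelianSchemes.PolarizedLevelPushforwardDetClass
import Literature.AlgebraicGeometry.Modules.SerreTwistClassOfForms
import Literature.AlgebraicGeometry.Modules.SerreTwistHyperplaneClass

/-!
# Quasi-projectivity of a scheme glued from framed pieces (F-9 (M2), § 1: the structure-free core)

Topic `Literature/AlgebraicGeometry/ModuliOfAbelianVarieties`; namespace
`Literature.AlgebraicGeometry.ModuliOfAbelianVarieties.FramedPieces`.  THEOREMS ONLY (no definition, no named fact, no instance,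
no notation, no `sorry`).

[MumfordFogartyKirwan1994] Ch. 7 §3 Thm. 7.9 (p. 139): the fine moduli scheme `A_{g,d,n}` — glued from the standard-frame slices
`V_R` of the covariant `H` ([MumfordFogartyKirwan1994] Ch. 7 §2 Prop. 7.6) — is quasi-projective.  The print proof descends the
Hilbert–Plücker bundle along `U_stable → Z_0` (Prop. 7.1); the tree's road («Q2», census of the F-9 chain) glues instead: ONE line
bundle `𝓛` on `M` whose global sections `F_R` cut out the slices (`M_{F_R} = U_R`, the (M1) file `SiegelModuliIntrinsicSections`), ONE
line bundle `𝓝` on `M` whose restriction to every slice carries finitely many sections with AFFINE non-vanishing loci covering it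
(the Plücker partner), and the gluing lemma [EGAII] Thm. 4.5.2 (remark) / [Hartshorne1977] II Lemma 5.14 in the tree's coefficient
currency (★ `GeneratingSections.CocycleSections.isQuasiProjectiveOver_of_affinePieces`, «(G3)»).

This edition lands § 1, the STRUCTURE-FREE CORE every producer plugs into — it mentions neither `SiegelFramedCovariant` nor
`SiegelFineModuliScheme` (whose letters are under repair, cell finding 8aea22b3) nor the Plücker identification (`PL`, in flight):

* **`FramedPieces.isQuasiProjectiveOver_of_framedPieces`** — `M` Noetherian and locally of finite type over a field `k`;
  coefficient data `S : CocycleSections ι W` on `M` (pieces `U_i := ⋃_a M_{S i a}`); a line bundle `𝓝` on `M` framed on a family of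
  opens (`IF : IFrames 𝓝 W'`); for every piece an open immersion `G i : Y i ⟶ M` with image `U_i` (the slice in its own model), an
  isomorphism `φ i : (G i)^*𝓝 ≅ N i` and global sections `t i k` of `N i` whose non-vanishing loci (read in the transported
  point-indexed frames) are AFFINE and COVER `Y i` ⟹ `M` is quasi-projective over `k`.  Proof: ★
  `GeneratingSections.exists_coeff_along_openImmersion_of_isAffineOpen` on every piece, then (G3).
* `FramedPieces.isQuasiProjectiveOver_of_framedPieces_of_iSup` — the same with the covering hypothesis «the images of the `G i`
  cover `M`» made explicit for the reader (it is implied by the per-piece covers).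
* § 2 (edition 2) **`FramedPieces.exists_lineBundle_sections_of_forms`** — the per-piece SECTIONS in the tree's coefficient currency:
  for any morphism `φ : Y ⟶ Proj 𝒜` and forms `F_c ∈ 𝒜_d` (`d > 0`) with `⋃ φ⁻¹D₊(F_c) = Y`, the line bundle `φ^*𝒪(d²)` GLUED from the
  cocycle `(F_{i(y′)}/F_{i(y)})^d` (★ `Modules.lineBundle`, chart choice `y ∈ φ⁻¹D₊(F_{i y})`) carries global sections `t_c` («`φ^*F_c^d`»,
  components `(F_c/F_{i y})^d` = ★ `formHomRatio`, which is `φ^*((F_b/F_a)^d)` — Mathlib `Away.isLocalizationElem`) whose non-vanishing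
  loci in its frame system are EXACTLY `φ⁻¹D₊(F_c)` ([Hartshorne1977] II Thm. 7.1 (a): `s_i = φ^*x_i`, `X_{s_i} = φ⁻¹D₊(x_i)`); so «forms
  with affine `φ⁻¹D₊(F_c)`» (★
  `UniversalFamilyQuasiProjective.exists_forms_isAffineOpen_le_iSup_eq_top`) ARE the sections § 1 consumes, up to the identification of
  `lineBundle` with the piece's bundle (the `PL` letter of the F-9 chain).
* § 3 (edition 3) **`PolarizedAbelianSchemeWithLevel.frameOpen_eq_opensRange_of_charts`** — the PIECES of the F-9 letter: for a
  triple `P` over `T` with cartesian charts `(PV R, j R)` (`hchart`), glue condition `hglue` and cover `hjcov` exactly as the chart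
  clauses of ★ `SiegelModuliSliceGlueData.exists_glued_of_representedCharts_of_specHom` / the `hF9` binder of ★
  `SiegelFineModuliSchemeOfCores`, MFK's open `U_R` of `P` IS the image of the `R`-chart: `frameOpen J P R = (j R).opensRange` (★
  (8β-b) `preimage_frameOpen_le`, `mem_frameOpen_iff`, `image_frameLocus_le_frameOpen_of_isOpenImmersion`, ★
  `exists_isBaseChangeVia_of_comp`) — so (M1)'s sections `F_R` (`M_{F_R} = frameOpen`) cut out exactly the slices § 1 wants;
  § 4 `compactSpace_of_charts`, `locallyOfFiniteType_of_charts` — the glued base is quasi-compact and of finite type when its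
  finitely many charts are (the `IsNoetherian`/`LocallyOfFiniteType` hypotheses of § 1);
  § 5 `FramedPieces.iSup_basicOpen_coeffAt_eq_of_frameSystems` («the locus of a section does not depend on the rank-one frame
  system», ★ `GeneratingSectionsFrameIndependence`) and **`FramedPieces.isQuasiProjectiveOver_of_framedPieces'`** = § 1 with the
  per-piece loci read in ANY rank-one frame system of `N i` (e.g. ★ `lineBundleFrameSystem` of § 2), not in the transported one.

Cell `hodgecm-mathlib` (D-0151), F-9 ROW 7 (M2) § 1; count-neutral: HC_CM is proved only modulo the 7 printed citations until rung 0
closes — nothing here is about HC.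

## References
* D. Mumford, J. Fogarty, F. Kirwan, *Geometric Invariant Theory*, 3rd ed. (1994), Ch. 7 §3 Thm. 7.9 (p. 139), Ch. 7 §2 Prop. 7.6
  (p. 136). [MumfordFogartyKirwan1994]
* A. Grothendieck, J. Dieudonné, *EGA II* (1961), Thm. 4.5.2 and the remark following it, Prop. 4.6.13 (ii). [EGAII]
* R. Hartshorne, *Algebraic Geometry*, GTM 52 (1977), II Lemma 5.14 (p. 118), II Thm. 7.6 (p. 154). [Hartshorne1977]
* U. Görtz, T. Wedhorn, *Algebraic Geometry I*, 2nd ed. (2020), Prop. 13.47 (pp. 392–393). [GortzWedhorn2020]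
-/

noncomputable section

universe u v w

open CategoryTheory AlgebraicGeometry TopologicalSpace Opposite
open Literature.AlgebraicGeometry.Modules Literature.AlgebraicGeometry.Motives
open Literature.AlgebraicGeometry.Motives.GeneratingSections
open Literature.AlgebraicGeometry.HodgeTheory (IsQuasiProjectiveOver)

namespace Literature.AlgebraicGeometry.ModuliOfAbelianVarieties

namespace FramedPieces

variable {k : Type u} [Field k] {M : SchemeOver k} [IsNoetherian M.left] [LocallyOfFiniteType M.hom]
  {α : Type v} {β : Type w} {W : α → M.left.Opens} {ι : Type} [Finite ι] (S : CocycleSections ι W)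
  {𝓝 : M.left.Modules} {W' : β → M.left.Opens} (IF : IFrames 𝓝 W')
  (Y : ι → Scheme.{u}) (G : ∀ i, Y i ⟶ M.left) [∀ i, IsOpenImmersion (G i)]
  (hG : ∀ i, (G i).opensRange = ⨆ a, M.left.basicOpen (S.coeff i a))
  (N : ∀ i, (Y i).Modules) (φ : ∀ i, (Scheme.Modules.pullback (G i)).obj 𝓝 ≅ N i)
  {κ : ι → Type} [∀ i, Finite (κ i)] (t : ∀ i, κ i → Γ(N i, ⊤))
  (hW' : ∀ i, ⨆ b, G i ⁻¹ᵁ W' b = ⊤)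

include hG in
/-- **QUASI-PROJECTIVITY FROM FRAMED PIECES** ([MumfordFogartyKirwan1994] Thm. 7.9 via the gluing road; [EGAII] 4.5.2 rem. /
Prop. 4.6.13 (ii)): `M` Noetherian, locally of finite type over a field; coefficient data `S` of a line bundle `𝓛` with pieces
`U_i = ⋃_a M_{S i a}`; a line bundle `𝓝` framed on opens `W' b` (`IF`); for every `i` an open immersion `G i : Y i ⟶ M` with image
`U_i`, `φ i : (G i)^*𝓝 ≅ N i` and sections `t i k ∈ Γ(Y i, N i)` whose non-vanishing loci — in the point-indexed frame system
`((IF.pullback (G i)).mapIso (φ i)).toFrameSystem (hW' i)` — are AFFINE and COVER `Y i`.  Then `M` is quasi-projective over `k`: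
★ `exists_coeff_along_openImmersion_of_isAffineOpen` turns each piece's sections into the coefficient data (`T`, `hT`, `haff`) of
★ `CocycleSections.isQuasiProjectiveOver_of_affinePieces`, whose covering hypothesis is the union of the per-piece covers.
[cite: MumfordFogartyKirwan1994, Ch. 7 §3 Theorem 7.9 (p. 139)] [cite: EGAII, Prop. 4.6.13 (ii)]
[cite: Hartshorne1977, II Lemma 5.14 (p. 118)] [cite: GortzWedhorn2020, Prop. 13.47 (pp. 392–393)] -/
theorem isQuasiProjectiveOver_of_framedPieces
    (haff : ∀ i c, IsAffineOpen (⨆ y, (Y i).basicOpen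
      (coeffAt (((IF.pullback (G i)).mapIso (φ i)).toFrameSystem (hW' i)) (fun _ => rfl) (t i) c y)))
    (hcov : ∀ i, ⨆ c, ⨆ y, (Y i).basicOpen
      (coeffAt (((IF.pullback (G i)).mapIso (φ i)).toFrameSystem (hW' i)) (fun _ => rfl) (t i) c y) = ⊤)
    (hU : ⨆ i, (G i).opensRange = ⊤) :
    IsQuasiProjectiveOver M := by
  classical
  -- the coefficient data of every piece, read on `M`
  choose T hT haffT hcovT using fun i =>
    exists_coeff_along_openImmersion_of_isAffineOpen (G i) IF (φ i) (t i) (hW' i)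
      (⨆ a, M.left.basicOpen (S.coeff i a)) (hG i) (haff i) (hcov i)
  have hcovM : ⨆ i, ⨆ c, ⨆ b, M.left.basicOpen (T i c b) = ⊤ := by
    simp_rw [hcovT, ← hG]
    exact hU
  exact CocycleSections.isQuasiProjectiveOver_of_affinePieces (Z := M) W' S
    (fun b b' => IF.tfOn b' b (W' b ⊓ W' b') inf_le_right inf_le_left) (fun b b' => IF.isUnit_tfOn_swap b b')
    T hT haffT hcovM

include hG in
/-- The covering hypothesis «`⋃ (G i)(Y i) = M`» follows from «the pieces `U_i` cover `M`» stated on `S` — the form the (M1) file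
delivers (`⋃_R frameOpen R = M` from `hjcov`). [cite: MumfordFogartyKirwan1994, Ch. 7 §2 Prop. 7.6 (p. 136)] -/
theorem isQuasiProjectiveOver_of_framedPieces_of_iSup
    (haff : ∀ i c, IsAffineOpen (⨆ y, (Y i).basicOpen
      (coeffAt (((IF.pullback (G i)).mapIso (φ i)).toFrameSystem (hW' i)) (fun _ => rfl) (t i) c y)))
    (hcov : ∀ i, ⨆ c, ⨆ y, (Y i).basicOpen
      (coeffAt (((IF.pullback (G i)).mapIso (φ i)).toFrameSystem (hW' i)) (fun _ => rfl) (t i) c y) = ⊤)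
    (hUS : ⨆ i, ⨆ a, M.left.basicOpen (S.coeff i a) = ⊤) :
    IsQuasiProjectiveOver M :=
  isQuasiProjectiveOver_of_framedPieces S IF Y G hG N φ t hW' haff hcov (by simp_rw [hG]; exact hUS)

/-! ## § 2 Forms of one degree as sections of a glued line bundle, with their non-vanishing loci -/

section Forms

variable {A : Type u} {σ : Type*} [CommRing A] [SetLike σ A] [AddSubgroupClass σ A]
  (𝒜 : ℕ → σ) [GradedRing 𝒜] {Y : Scheme.{u}} (φ : Y ⟶ Proj 𝒜) {κv : Type} {d : ℕ} (F : κv → A)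
  (hF : ∀ c, F c ∈ 𝒜 d) (hd : 0 < d)

/-- Restricting twice is restricting once (sections of `𝒪_Y`). [folklore] -/
private theorem secRes_secRes' {U V W : Y.Opens} (h : V ≤ U) (h' : W ≤ V) (s : Γ(Y, U)) :
    Modules.secRes Y h' (Modules.secRes Y h s) = Modules.secRes Y (h'.trans h) s :=
  Modules.secRes_secRes h h' s

include hF hd in
/-- The cocycle identity of the form ratios over any small open: `(F_b/F_a)| · (F_c/F_b)| = (F_c/F_a)|` on `V ≤ φ⁻¹D₊(F_a) ∩ φ⁻¹D₊(F_b)`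
(★ `formHomRatio_mul_formHomRatio`, restricted). [folklore] -/
private theorem secRes_formHomRatio_mul (a b c : κv) {V : Y.Opens} (ha : V ≤ φ ⁻¹ᵁ Proj.basicOpen 𝒜 (F a))
    (hb : V ≤ φ ⁻¹ᵁ Proj.basicOpen 𝒜 (F b)) :
    Modules.secRes Y ha (formHomRatio φ F hF hd a b) * Modules.secRes Y hb (formHomRatio φ F hF hd b c) =
      Modules.secRes Y ha (formHomRatio φ F hF hd a c) := by
  have h := congr_arg (Modules.secRes Y (le_inf ha hb : V ≤ _ ⊓ _)) (formHomRatio_mul_formHomRatio φ F hF hd a b c)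
  rw [map_mul] at h
  simp only [Modules.secRes, ← CommRingCat.comp_apply, ← Functor.map_comp] at h
  exact h

include hF hd in
/-- **FORMS OF ONE DEGREE AS GLOBAL SECTIONS OF THE GLUED LINE BUNDLE `φ^*𝒪(d²)`, WITH THEIR LOCI** ([Hartshorne1977] II Thm. 7.1 (a)
for `φ` followed by the morphism to projective space the `F_c` define; II Prop. 5.12: `𝒪(n)` by the transition functions
`(x_i/x_j)^n`).  For `φ : Y ⟶ Proj 𝒜` and forms `F_c ∈ 𝒜_d`, `d > 0`, with `⋃_c φ⁻¹D₊(F_c) = Y`: choosing for every point `y` an index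
`i y` with `y ∈ φ⁻¹D₊(F_{i y})`, the units `(F_{i y′}/F_{i y})^d` (★ `formHomRatio` — NB Mathlib's `Away.isLocalizationElem` makes it
the `d`-th power of the ratio, so the glued bundle is `φ^*𝒪(d·d)`, class of record ★ `SerreTwist.cechPic_mk_eq_inv_detClass_serreTwist_of_forms`)
form a cocycle `cY` (★ `formHomRatio_mul_formHomRatio`), and the families `((F_c / F_{i y})^d)_y` glue to global sections `t_c` of ★
`Modules.lineBundle cY` whose non-vanishing loci — read in the frame system ★ `lineBundleFrameSystem` — are `φ⁻¹D₊(F_c)` (★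
`basicOpen_formHomRatio`; loci of powers are loci).  This is the `(N, t, loci)` input of § 1 for a
piece `Y` immersed in a projective space once `(G i)^*𝓝 ≅ lineBundle cY` is known (the F-9 `PL` letter, read through ★
`nonempty_iso_iff_detClass_eq` and ★ `detClass_lineBundle : detClass _ = CechPic.mk cY`).
[cite: Hartshorne1977, II Thm. 7.1 (p. 150)] [cite: Hartshorne1977, II Prop. 5.12 (p. 117)] -/
theorem exists_lineBundle_sections_of_forms (hcov : ⨆ c, φ ⁻¹ᵁ Proj.basicOpen 𝒜 (F c) = ⊤) :
    ∃ (cY : UnitCocycle Y) (i : Y → κv) (hU : ∀ y, cY.U y = φ ⁻¹ᵁ Proj.basicOpen 𝒜 (F (i y)))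
      (_ : ∀ (y y' : Y) (V : Y.Opens) (hy : V ≤ cY.U y) (hy' : V ≤ cY.U y'),
        cY.g y y' V hy hy' = Modules.secRes Y (hy.trans (hU y).le) (formHomRatio φ F hF hd (i y) (i y')))
      (t : κv → Γ(Modules.lineBundle cY, ⊤)),
      (∀ c y, cY.comp (t c) y =
        Modules.secRes Y ((inf_le_right : (⊤ : Y.Opens) ⊓ cY.U y ≤ cY.U y).trans (hU y).le) (formHomRatio φ F hF hd (i y) c)) ∧
      ∀ c, ⨆ y, Y.basicOpen (coeffAt cY.lineBundleFrameSystem (fun _ => rfl) t c y) = φ ⁻¹ᵁ Proj.basicOpen 𝒜 (F c) := by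
  classical
  -- the chart choice
  have hmem : ∀ y : Y, ∃ c, y ∈ φ ⁻¹ᵁ Proj.basicOpen 𝒜 (F c) := fun y => by
    have hy : y ∈ (⨆ c, φ ⁻¹ᵁ Proj.basicOpen 𝒜 (F c)) := by rw [hcov]; trivial
    exact Opens.mem_iSup.mp hy
  choose i hi using hmem
  let W : κv → Y.Opens := fun c => φ ⁻¹ᵁ Proj.basicOpen 𝒜 (F c)
  -- the cocycle `g y y' := (F_{i y'}/F_{i y})|`
  let cY : UnitCocycle Y :=
    { U := fun y => W (i y)
      mem := hi
      g := fun y y' V hy hy' => Modules.secRes Y hy (formHomRatio φ F hF hd (i y) (i y'))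
      map_g := fun y y' V V' hy hy' h => by rw [Modules.secRes_secRes]
      g_mul := fun y y' y'' V hy hy' hy'' => secRes_formHomRatio_mul 𝒜 φ F hF hd _ _ _ hy hy'
      g_self := fun y V hy => by rw [formHomRatio_self, map_one] }
  -- the sections `t_c := (F_c/F_{i y})_y`
  have hglue : ∀ c, cY.IsGlueFamily ⊤ fun y =>
      Modules.secRes Y (inf_le_right : (⊤ : Y.Opens) ⊓ cY.U y ≤ cY.U y) (formHomRatio φ F hF hd (i y) c) := by
    intro c y y' V' hV hy hy'
    change Modules.secRes Y _ (Modules.secRes Y _ (formHomRatio φ F hF hd (i y) c)) =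
      Modules.secRes Y hy (formHomRatio φ F hF hd (i y) (i y')) * Modules.secRes Y _ (Modules.secRes Y _ (formHomRatio φ F hF hd (i y') c))
    rw [Modules.secRes_secRes, Modules.secRes_secRes]
    exact (secRes_formHomRatio_mul 𝒜 φ F hF hd (i y) (i y') c hy hy').symm
  let t : κv → Γ(Modules.lineBundle cY, ⊤) := fun c => cY.mkSection ⊤ _ (hglue c)
  refine ⟨cY, i, fun _ => rfl, fun _ _ _ _ _ => rfl, t, fun c y => rfl, fun c => ?_⟩
  -- the loci: the coefficient of `t_c` in the frame at `y` is `(t_c)_y|`, whose basic open is `U_y ∩ φ⁻¹D₊(F_c)`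
  have hcoeff : ∀ y, Y.basicOpen (coeffAt cY.lineBundleFrameSystem (fun _ => rfl) t c y) = cY.U y ⊓ W c := by
    intro y
    have key : coeffAt cY.lineBundleFrameSystem (fun _ => rfl) t c y =
        Modules.secRes Y (le_inf le_rfl le_rfl : cY.U y ≤ cY.U y ⊓ cY.U y)
          (cY.comp ((Modules.lineBundle cY).presheaf.map (homOfLE (le_top : cY.U y ≤ ⊤)).op (t c)) y) := by
      rw [coeffAt]
      have hs := cY.eq_smul_lineBundleGen y (cY.U y) le_rfl
        ((Modules.lineBundle cY).presheaf.map (homOfLE (le_top : cY.U y ≤ ⊤)).op (t c))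
      rw [← cY.basisSection_lineBundleFrame y] at hs
      have hcoord := congr_arg
        (fun s => coord (cY.lineBundleFrame y) (𝟙 (cY.U y)) s (cY.lineBundleFrameSystem.idx (fun _ => rfl) y)) hs
      simp only at hcoord
      have hidx : cY.lineBundleFrameSystem.idx (fun _ => rfl) y = PUnit.unit := rfl
      rw [coord_smul, hidx, coord_basisSection, if_pos rfl, mul_one] at hcoord
      exact hcoord
    rw [key, cY.comp_map, cY.comp_mkSection]
    change Y.basicOpen (Modules.secRes Y _ (Modules.secRes Y _ (Modules.secRes Y _ (formHomRatio φ F hF hd (i y) c)))) = _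
    rw [Modules.secRes_secRes, Modules.secRes_secRes, Modules.secRes, Scheme.basicOpen_res, basicOpen_formHomRatio]
    change cY.U y ⊓ (W (i y) ⊓ W c) = cY.U y ⊓ W c
    rw [← inf_assoc, inf_idem]
  have hUtop : ⨆ y, cY.U y = ⊤ := top_le_iff.mp fun y _ => Opens.mem_iSup.mpr ⟨y, cY.mem y⟩
  simp_rw [hcoeff]
  rw [← iSup_inf_eq, hUtop, top_inf_eq]

end Forms

end FramedPieces

end Literature.AlgebraicGeometry.ModuliOfAbelianVarieties

/-! ## § 3 The pieces: `frameOpen J P R` is the image of the `R`-chart -/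

namespace Literature.AlgebraicGeometry.AbelianSchemes

namespace PolarizedAbelianSchemeWithLevel

open CategoryTheory.Limits
open Literature.AlgebraicGeometry.Morphisms (projectiveSpaceInt)
open Literature.AlgebraicGeometry.Morphisms.ProjFrame (frameLocus preimage_frameLocus)

variable {g N : ℕ} {δ : Fin g → ℕ} (J : Type) {T : Scheme.{0}} [IsLocallyNoetherian T]
  (P : PolarizedAbelianSchemeWithLevel g N δ T)
  {V : (Fin (Nat.card J + 2) → (Fin g ⊕ Fin g → ZMod N)) → Scheme.{0}}
  (PV : ∀ R, PolarizedAbelianSchemeWithLevel g N δ (V R))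

/-- **`U_R(P)` CONTAINS THE IMAGE OF ANY `R`-FRAMED CHART**: if `(G, Ĝ)` exhibits a triple `Q` over `V` as the pull-back of `P`
along an open immersion `v : V → T` and `Q` is `R`-framed everywhere (`frameOpen J Q R = ⊤`), then `v(V) ⊆ frameOpen J P R`
(transport the local linear rigidifications of `Q` to `P|_{v}` along the comparison over `𝟙 V` — ★ `exists_isBaseChangeVia_of_comp`,
★ `preimage_frameOpen_le` — and then to `P` over the open immersions `U ↪ V ↪ T` — ★ `IsBaseChangeVia.isLinearRigidification_comp`,
★ `image_frameLocus_le_frameOpen_of_isOpenImmersion`). [cite: MumfordFogartyKirwan1994, Ch. 7 §2 Prop. 7.6 (p. 136)] -/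
theorem opensRange_le_frameOpen_of_isBaseChangeVia (R : Fin (Nat.card J + 2) → (Fin g ⊕ Fin g → ZMod N))
    {W : Scheme.{0}} (v : W ⟶ T) [IsOpenImmersion v] (Q : PolarizedAbelianSchemeWithLevel g N δ W)
    {G : Q.A.X.left ⟶ P.A.X.left} {Ĝ : Q.D.hat.X.left ⟶ P.D.hat.X.left} (h : Q.IsBaseChangeVia P v G Ĝ)
    (hQ : frameOpen J Q R = ⊤) : v.opensRange ≤ frameOpen J P R := by
  haveI : IsLocallyNoetherian W := isLocallyNoetherian_of_isOpenImmersion v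
  -- `P|_v` is a pull-back of `Q` along `𝟙 W`
  have h₁ : (P.baseChange v).IsBaseChangeVia P (𝟙 W ≫ v) (pullback.fst P.A.X.hom v) (pullback.fst P.D.hat.X.hom v) := by
    rw [Category.id_comp]; exact P.baseChange_isBaseChangeVia v
  obtain ⟨m, mh, -, -, hrel⟩ := exists_isBaseChangeVia_of_comp h₁ h
  rintro _ ⟨y, rfl⟩
  -- `y ∈ frameOpen J (P|_v) R`
  have hy : y ∈ frameOpen J (P.baseChange v) R := by
    apply preimage_frameOpen_le J Q R hrel
    change (𝟙 W) y ∈ frameOpen J Q R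
    rw [hQ]; trivial
  obtain ⟨U, ι, hι, hyU⟩ := (mem_frameOpen_iff J (P.baseChange v) R y).mp hy
  -- move the rigidification of `(P|_v)|_U` to `P|_{U ↪ W ↪ T}`
  have h₂ : ((P.baseChange v).baseChange U.ι).IsBaseChangeVia P (U.ι ≫ v)
      (pullback.fst (P.baseChange v).A.X.hom U.ι ≫ pullback.fst P.A.X.hom v)
      (pullback.fst (P.baseChange v).D.hat.X.hom U.ι ≫ pullback.fst P.D.hat.X.hom v) :=
    ((P.baseChange v).baseChange_isBaseChangeVia U.ι).trans (P.baseChange_isBaseChangeVia v)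
  have h₃ : (P.baseChange (U.ι ≫ v)).IsBaseChangeVia P (𝟙 _ ≫ U.ι ≫ v)
      (pullback.fst P.A.X.hom (U.ι ≫ v)) (pullback.fst P.D.hat.X.hom (U.ι ≫ v)) := by
    rw [Category.id_comp]; exact P.baseChange_isBaseChangeVia (U.ι ≫ v)
  obtain ⟨m', mh', -, -, hrel'⟩ := exists_isBaseChangeVia_of_comp h₃ h₂
  have hκ : (P.baseChange (U.ι ≫ v)).IsLinearRigidification J (m' ≫ ι) := hrel'.isLinearRigidification_comp hι
  have hloc : frameLocus (markedTuple J (P.baseChange (U.ι ≫ v)) (m' ≫ ι) R) =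
      (𝟙 _ : (U : Scheme.{0}) ⟶ U) ⁻¹ᵁ frameLocus (markedTuple J ((P.baseChange v).baseChange U.ι) ι R) := by
    rw [preimage_frameLocus]
    exact congrArg frameLocus (funext fun k => (comp_markedTuple J R hrel' k).symm)
  refine image_frameLocus_le_frameOpen_of_isOpenImmersion J P R (U.ι ≫ v) (m' ≫ ι) hκ ?_
  obtain ⟨z, hz, rfl⟩ := hyU
  refine ⟨z, ?_, (Scheme.Hom.comp_apply U.ι v z).symm⟩
  rw [hloc]
  exact hz

/-- **THE PIECES OF THE F-9 LETTER: `frameOpen J P R = (j R)(V R)`.**  For a triple `P` over a locally Noetherian `T` with charts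
`(PV R, j R)` — `j R : V R → T` open immersions, `(PV R).IsBaseChangeVia P (j R) (Gc R) (Ĝc R)` (`hchart`) —, the glue condition
`(j R')⁻¹ (j R)(V R) = frameOpen J (PV R') R` (`hglue`) and the cover `⋃ (j R)(V R) = T` (`hjcov`) — verbatim the chart clauses of ★
`exists_glued_of_representedCharts_of_specHom` / the `hF9` binder of ★ `SiegelFineModuliSchemeOfCores` —, MFK's open set `U_R` of `P`
IS the image of the `R`-chart.  `⊆`: a point of `U_R(P)` lies on some chart `R'` (`hjcov`), and `U_R` pulls back along the relation
`hchart R'` (★ `preimage_frameOpen_le`) into `frameOpen J (PV R') R = (j R')⁻¹ (j R)(V R)` (`hglue`); `⊇`: `hglue R R` makes the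
`R`-chart `R`-framed everywhere, and `opensRange_le_frameOpen_of_isBaseChangeVia`.
[cite: MumfordFogartyKirwan1994, Ch. 7 §2 Prop. 7.6 (p. 136)] [cite: MumfordFogartyKirwan1994, Ch. 3 §1 Definition 3.3 (p. 68)] -/
theorem frameOpen_eq_opensRange_of_charts (j : ∀ R : Fin (Nat.card J + 2) → (Fin g ⊕ Fin g → ZMod N), V R ⟶ T)
    [∀ R, IsOpenImmersion (j R)]
    {Gc : ∀ R, (PV R).A.X.left ⟶ P.A.X.left} {Ĝc : ∀ R, (PV R).D.hat.X.left ⟶ P.D.hat.X.left}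
    (hchart : ∀ R, (PV R).IsBaseChangeVia P (j R) (Gc R) (Ĝc R))
    (hglue : ∀ R R', (j R') ⁻¹ᵁ (j R).opensRange = frameOpen J (PV R') R)
    (hjcov : ⨆ R, (j R).opensRange = ⊤) (R : Fin (Nat.card J + 2) → (Fin g ⊕ Fin g → ZMod N)) :
    frameOpen J P R = (j R).opensRange := by
  apply le_antisymm
  · intro x hx
    have hx' : x ∈ (⨆ R', (j R').opensRange) := by rw [hjcov]; trivial
    obtain ⟨R', hxR'⟩ := Opens.mem_iSup.mp hx'
    obtain ⟨y, rfl⟩ := hxR'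
    have hy : y ∈ (j R') ⁻¹ᵁ frameOpen J P R := hx
    have hy' : y ∈ frameOpen J (PV R') R := preimage_frameOpen_le J P R (hchart R') hy
    rw [← hglue R R'] at hy'
    exact hy'
  · refine opensRange_le_frameOpen_of_isBaseChangeVia J P R (j R) (PV R) (hchart R) ?_
    rw [← hglue R R]
    exact Scheme.Hom.preimage_opensRange (j R)

/-! ## § 4 The glued base inherits quasi-compactness and finite type from its charts -/

omit [IsLocallyNoetherian T] in
/-- **A scheme covered by finitely many open charts with quasi-compact sources is quasi-compact** (the glued moduli scheme
`A⁰ = ⋃_R V_R` of [MumfordFogartyKirwan1994] Prop. 7.6: finitely many `(m+2)`-tuples `R`, each slice quasi-compact).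
[cite: MumfordFogartyKirwan1994, Ch. 7 §2 Prop. 7.6 (p. 136)] -/
theorem compactSpace_of_charts {ι' : Type} [Finite ι'] {V' : ι' → Scheme.{0}} [∀ R, CompactSpace (V' R)]
    (j : ∀ R, V' R ⟶ T) [∀ R, IsOpenImmersion (j R)] (hjcov : ⨆ R, (j R).opensRange = ⊤) : CompactSpace T := by
  refine ⟨?_⟩
  have h : (Set.univ : Set T) = ⋃ R, Set.range (j R) := by
    have h' := congrArg (fun U : T.Opens => (U : Set T)) hjcov
    simp only [Opens.coe_iSup, Opens.coe_top] at h'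
    exact h'.symm
  rw [h]
  exact isCompact_iUnion fun R => isCompact_range (j R).continuous

omit [IsLocallyNoetherian T] in
/-- **… and a morphism out of it is locally of finite type as soon as it is so on the charts** (finite type is local at the
source, Mathlib `IsZariskiLocalAtSource`; the slices `V_R → Spec ℚ` are of finite type). [cite: MumfordFogartyKirwan1994, Ch. 7 §2 Prop. 7.6 (p. 136)] -/
theorem locallyOfFiniteType_of_charts {ι' : Type} {V' : ι' → Scheme.{0}} {S : Scheme.{0}} (f : T ⟶ S)
    (j : ∀ R, V' R ⟶ T) [∀ R, IsOpenImmersion (j R)] (hjcov : ⨆ R, (j R).opensRange = ⊤)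
    [∀ R, LocallyOfFiniteType (j R ≫ f)] : LocallyOfFiniteType f := by
  have hcov : ∀ x : T, ∃ R y, j R y = x := fun x => by
    have hx : x ∈ (⨆ R, (j R).opensRange) := by rw [hjcov]; trivial
    obtain ⟨R, y, hy⟩ := Opens.mem_iSup.mp hx
    exact ⟨R, y, hy⟩
  exact IsZariskiLocalAtSource.of_openCover (P := @LocallyOfFiniteType)
    (Scheme.Cover.mkOfCovers ι' V' j hcov inferInstance) fun R =>
      (inferInstance : LocallyOfFiniteType (j R ≫ f))

end PolarizedAbelianSchemeWithLevel

end Literature.AlgebraicGeometry.AbelianSchemes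

/-! ## § 5 The per-piece loci may be read in any rank-one frame system -/

namespace Literature.AlgebraicGeometry.ModuliOfAbelianVarieties

namespace FramedPieces

section AnyFrame

variable {Y : Scheme.{u}} {E : Y.Modules} (F F' : FrameSystem E) (h : ∀ y, F.rank y = 1) (h' : ∀ y, F'.rank y = 1)
  {κ : Type} (t : κ → Γ(E, ⊤))

/-- **The non-vanishing locus `Y_{t_c}` of a global section of a line bundle does not depend on the rank-one frame system in which
its coefficients are read** ([Hartshorne1977] II, proof of Thm. 7.1: «`X_s` is well defined»; ★
`GeneratingSectionsFrameIndependence.iSup_basicOpen_coeff_le_of_rescale` in both directions, the rescaling units being the frame-change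
coefficients ★ `isUnit_coord_basisSection`). [cite: Hartshorne1977, II Thm. 7.1 (p. 150)] -/
theorem iSup_basicOpen_coeffAt_eq_of_frameSystems (c : κ) :
    ⨆ y, Y.basicOpen (coeffAt F h t c y) = ⨆ y, Y.basicOpen (coeffAt F' h' t c y) := by
  have hU : ∀ G : FrameSystem E, ⨆ y, G.U y = ⊤ := fun G => eq_top_iff.mpr fun y _ => Opens.mem_iSup.mpr ⟨y, G.mem y⟩
  apply le_antisymm
  · exact iSup_basicOpen_coeff_le_of_rescale (CocycleSections.ofFrameSystem F h t) (CocycleSections.ofFrameSystem F' h' t) (hU F')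
      (fun x y => coord (F.frame x) (homOfLE (inf_le_left : F.U x ⊓ F'.U y ≤ F.U x))
        (E.presheaf.map (homOfLE (inf_le_right : F.U x ⊓ F'.U y ≤ F'.U y)).op (basisSection (F'.frame y) (F'.idx h' y)))
        (F.idx h x))
      (fun x y => isUnit_coord_basisSection F F' h h' x y)
      (fun i x y => map_coeffAt_eq_coord_mul_map_coeffAt F F' h h' t i x y) c
  · exact iSup_basicOpen_coeff_le_of_rescale (CocycleSections.ofFrameSystem F' h' t) (CocycleSections.ofFrameSystem F h t) (hU F)
      (fun x y => coord (F'.frame x) (homOfLE (inf_le_left : F'.U x ⊓ F.U y ≤ F'.U x))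
        (E.presheaf.map (homOfLE (inf_le_right : F'.U x ⊓ F.U y ≤ F.U y)).op (basisSection (F.frame y) (F.idx h y)))
        (F'.idx h' x))
      (fun x y => isUnit_coord_basisSection F' F h' h x y)
      (fun i x y => map_coeffAt_eq_coord_mul_map_coeffAt F' F h' h t i x y) c

end AnyFrame

variable {k : Type u} [Field k] {M : SchemeOver k} [IsNoetherian M.left] [LocallyOfFiniteType M.hom]
  {α : Type v} {β : Type w} {W : α → M.left.Opens} {ι : Type} [Finite ι] (S : CocycleSections ι W)
  {𝓝 : M.left.Modules} {W' : β → M.left.Opens} (IF : IFrames 𝓝 W')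
  (Y : ι → Scheme.{u}) (G : ∀ i, Y i ⟶ M.left) [∀ i, IsOpenImmersion (G i)]
  (hG : ∀ i, (G i).opensRange = ⨆ a, M.left.basicOpen (S.coeff i a))
  (N : ∀ i, (Y i).Modules) (φ : ∀ i, (Scheme.Modules.pullback (G i)).obj 𝓝 ≅ N i)
  {κ : ι → Type} [∀ i, Finite (κ i)] (t : ∀ i, κ i → Γ(N i, ⊤))
  (FN : ∀ i, FrameSystem (N i)) (hFN : ∀ i y, (FN i).rank y = 1)

include IF φ hG in
/-- **§ 1 WITH THE LOCI READ IN ANY RANK-ONE FRAME SYSTEM of the piece bundles `N i`** (e.g. the canonical frames ★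
`lineBundleFrameSystem` of a glued `lineBundle`, as § 2 delivers them): by § 5's frame independence the hypotheses transport to the
frame system of § 1 (the one transported from `IF` along `G i` and `φ i`).
[cite: MumfordFogartyKirwan1994, Ch. 7 §3 Theorem 7.9 (p. 139)] [cite: Hartshorne1977, II Thm. 7.1 (p. 150)] -/
theorem isQuasiProjectiveOver_of_framedPieces' (hW' : ∀ i, ⨆ b, G i ⁻¹ᵁ W' b = ⊤)
    (haff : ∀ i c, IsAffineOpen (⨆ y, (Y i).basicOpen (coeffAt (FN i) (hFN i) (t i) c y)))
    (hcov : ∀ i, ⨆ c, ⨆ y, (Y i).basicOpen (coeffAt (FN i) (hFN i) (t i) c y) = ⊤)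
    (hU : ⨆ i, (G i).opensRange = ⊤) : IsQuasiProjectiveOver M := by
  have key : ∀ i c, ⨆ y, (Y i).basicOpen (coeffAt (FN i) (hFN i) (t i) c y) =
      ⨆ y, (Y i).basicOpen
        (coeffAt (((IF.pullback (G i)).mapIso (φ i)).toFrameSystem (hW' i)) (fun _ => rfl) (t i) c y) := fun i c =>
    iSup_basicOpen_coeffAt_eq_of_frameSystems (FN i) _ (hFN i) (fun _ => rfl) (t i) c
  refine isQuasiProjectiveOver_of_framedPieces S IF Y G hG N φ t hW' (fun i c => ?_) (fun i => ?_) hU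
  · rw [← key]; exact haff i c
  · simp_rw [← key]; exact hcov i

end FramedPieces

end Literature.AlgebraicGeometry.ModuliOfAbelianVarieties

/-! ## § 6 THE `hF9` CLOSER OF THE CORES FILE (edition 4) -/

namespace Literature.AlgebraicGeometry.ModuliOfAbelianVarieties

namespace SiegelFineModuliScheme

open CategoryTheory.Limits Literature.AlgebraicGeometry.AbelianSchemes
open Literature.AlgebraicGeometry.Morphisms.ProjFrame (frameDetSection slice sliceι isClosedImmersion_sliceι)
open Literature.AlgebraicGeometry.ProjectiveSpace.ProjFrame (stdChart)
open Literature.AlgebraicGeometry.Morphisms.ProjCech (PP toSpec grading)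
open PolarizedAbelianSchemeWithLevel AbelianSchemeOver SiegelFramedCovariant UniversalFamilyQuasiProjective FramedPieces

/-- **F-9 ROW 7 — THE `hF9` BINDER OF THE CORES FILE, DISCHARGED modulo the Plücker clause `𝓗.PL`**
([MumfordFogartyKirwan1994] Thm. 7.9 «`A_{g,d,n}` is quasi-projective», by the road of Prop. 7.6 / Thm. 7.10 WITHOUT GIT:
the slice-glued fine moduli scheme `𝓜.M = ⋃_R j_R(V_R)` is quasi-projective over `ℚ`, and so is the total space of its universal
abelian scheme).  Road: `𝓜.M` is quasi-compact and locally of finite type (finitely many quasi-compact slices `V_R ↪ H`);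
★ (M1) `exists_cocycleSections_frameOpen` gives intrinsic cocycle sections on `𝓜.M` with loci `U_R(𝓜.univ) = j_R(V_R)` (§ 3);
each slice is immersed in `𝐏^r_ℚ` through `ι_H` (`PL`), so forms `G_{R,c}` of one common degree `D` (`m ∣ D`) have affine loci
covering `V_R` and are sections of the glued line bundle `cY_R` of `𝒪_{V_R}(D²)` (§ 2, ★ `cechPic_mk_eq_inv_detClass_serreTwist_of_forms`);
the Plücker partner `Π(𝓜.univ)` of `PL` — natural in the triple (★ `detClass_plucker_partner_of_isBaseChangeVia` along the charts
`hchart`, ★ `…_baseChange` along `V_R ↪ H`) — glues to ONE line bundle `𝓝` on `𝓜.M` with `j_R^*𝓝 ≅ cY_R` (line bundles with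
equal classes are isomorphic, ★ `nonempty_iso_iff_detClass_eq`); ★ `isQuasiProjectiveOver_of_framedPieces'` concludes, and ★ (9d)
`isQuasiProjectiveOver_univ` gives the universal family.  The statement is the `hF9` binder of ★ `exists_threshold_siegelFineModuliScheme_of_cores`
VERBATIM with `PL 𝓗` instantiated at ★ `SiegelFramedCovariant.PL`.
[cite: MumfordFogartyKirwan1994, Ch. 7 §3 Theorem 7.9 (p. 139)] [cite: MumfordFogartyKirwan1994, Ch. 7 §2 Prop. 7.6 (p. 136)]
[cite: Hartshorne1977, II Thm. 7.6 (p. 154)] -/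
theorem isQuasiProjectiveOver_of_charts_of_PL (g N : ℕ) (δ : Fin g → ℕ) (J : Type) [Finite J] (_hg : 0 < g)
    (hδ : IsPolarizationType δ) (hN : 3 ≤ N) (hJ : Nat.card J + 1 = 6 ^ g * polarizationDegree δ)
    (𝓗 : SiegelFramedCovariant g N δ J) (hft : LocallyOfFiniteType 𝓗.H.hom) (hPL : 𝓗.PL)
    (𝓜 : SiegelFineModuliScheme g N δ)
    (j : ∀ R : Fin (Nat.card J + 2) → (Fin g ⊕ Fin g → ZMod N),
      slice (fun k => (𝓗.H.left.basicOpen (frameDetSection (markedTuple J 𝓗.univ 𝓗.emb R) (stdChart (Nat.card J)))).ι ≫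
        markedTuple J 𝓗.univ 𝓗.emb R k) (stdChart (Nat.card J)) (𝓗.preU_ι_markedTuple_stdChart_eq_top R) ⟶ 𝓜.M.left)
    (hj : ∀ R, IsOpenImmersion (j R))
    (hjq : ∀ R, j R ≫ 𝓜.M.hom = (sliceι _ _ (𝓗.preU_ι_markedTuple_stdChart_eq_top R) ≫
      (𝓗.H.left.basicOpen (frameDetSection (markedTuple J 𝓗.univ 𝓗.emb R) (stdChart (Nat.card J)))).ι) ≫ 𝓗.H.hom)
    (Gc : ∀ R, (𝓗.univ.baseChange (sliceι _ _ (𝓗.preU_ι_markedTuple_stdChart_eq_top R) ≫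
      (𝓗.H.left.basicOpen (frameDetSection (markedTuple J 𝓗.univ 𝓗.emb R) (stdChart (Nat.card J)))).ι)).A.X.left ⟶
        𝓜.univ.A.X.left)
    (Ĝc : ∀ R, (𝓗.univ.baseChange (sliceι _ _ (𝓗.preU_ι_markedTuple_stdChart_eq_top R) ≫
      (𝓗.H.left.basicOpen (frameDetSection (markedTuple J 𝓗.univ 𝓗.emb R) (stdChart (Nat.card J)))).ι)).D.hat.X.left ⟶
        𝓜.univ.D.hat.X.left)
    (hchart : ∀ R, (𝓗.univ.baseChange (sliceι _ _ (𝓗.preU_ι_markedTuple_stdChart_eq_top R) ≫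
        (𝓗.H.left.basicOpen (frameDetSection (markedTuple J 𝓗.univ 𝓗.emb R) (stdChart (Nat.card J)))).ι)).IsBaseChangeVia
          𝓜.univ (j R) (Gc R) (Ĝc R))
    (hglue : ∀ R R', (j R') ⁻¹ᵁ (j R).opensRange =
        frameOpen J (𝓗.univ.baseChange (sliceι _ _ (𝓗.preU_ι_markedTuple_stdChart_eq_top R') ≫
          (𝓗.H.left.basicOpen (frameDetSection (markedTuple J 𝓗.univ 𝓗.emb R') (stdChart (Nat.card J)))).ι)) R)
    (hjcov : ⨆ R, (j R).opensRange = ⊤) :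
    IsQuasiProjectiveOver 𝓜.M ∧ IsQuasiProjectiveOver (Over.mk (𝓜.univ.A.X.hom ≫ 𝓜.M.hom) : SchemeOver ℚ) := by
  classical
  haveI : NeZero N := ⟨by omega⟩
  haveI := 𝓗.isLocallyNoetherian
  haveI := 𝓜.isLocallyNoetherian
  haveI := hj
  -- the slices `V_R ↪ H`
  let jV := fun R : Fin (Nat.card J + 2) → (Fin g ⊕ Fin g → ZMod N) =>
    sliceι _ _ (𝓗.preU_ι_markedTuple_stdChart_eq_top R) ≫
      (𝓗.H.left.basicOpen (frameDetSection (markedTuple J 𝓗.univ 𝓗.emb R) (stdChart (Nat.card J)))).ι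
  have hjVimm : ∀ R, IsImmersion (jV R) := fun R => by
    haveI := isClosedImmersion_sliceι _ _ (𝓗.preU_ι_markedTuple_stdChart_eq_top R); infer_instance
  -- the Plücker clause
  obtain ⟨hcpt, r, ιH, hιH, _, Gr, hGr₁, hGr₂, m, hm, s, k, hk, a, c, hPLeq⟩ := hPL
  letI := MvPolynomial.gradedAlgebra (σ := Fin (r + 1)) (R := ℚ)
  -- quasi-compactness and finite type
  have hcV := fun R => compactSpace_of_isImmersion (jV R)
  have hlnV := fun R => 𝓗.isLocallyNoetherian_slice R
  haveI : CompactSpace 𝓜.M.left := compactSpace_of_charts j hjcov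
  haveI : IsNoetherian 𝓜.M.left := {}
  haveI : ∀ R, LocallyOfFiniteType (j R ≫ 𝓜.M.hom) := fun R => by
    rw [hjq R]; haveI := hft; infer_instance
  haveI : LocallyOfFiniteType 𝓜.M.hom := locallyOfFiniteType_of_charts 𝓜.M.hom j hjcov
  -- (M1): intrinsic cocycle sections with loci `U_R(𝓜.univ) = j_R(V_R)` (§ 3)
  obtain ⟨W, S, hS⟩ := exists_cocycleSections_frameOpen 𝓜.M.hom 𝓜.univ J hJ (by omega)
  have hG : ∀ R, (j R).opensRange = ⨆ t, 𝓜.M.left.basicOpen (S.coeff R t) := fun R => by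
    rw [hS R]
    exact (frameOpen_eq_opensRange_of_charts J 𝓜.univ (fun R => 𝓗.univ.baseChange (jV R)) j hchart hglue hjcov R).symm
  -- forms of one common degree `D` (`m ∣ D`) on the slices through `ι_H`
  haveI : ∀ R, IsImmersion (jV R ≫ ιH) := fun R => inferInstance
  obtain ⟨D, n, G, hD, hmD, hGdeg, haffG, hcovG⟩ :=
    exists_forms_common_degree (grading ℚ r) (fun R => jV R ≫ ιH) hm
  -- § 2: the glued line bundles `cY_R` of `𝒪_{V_R}(D²)` with the forms as sections
  choose cY i hU hg t _ hloc using fun R =>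
    FramedPieces.exists_lineBundle_sections_of_forms (grading ℚ r) (jV R ≫ ιH) (G R) (hGdeg R) hD (hcovG R)
  have hBz : ∀ R, CechPic.mk (cY R) = (detClass (SerreTwist.isFiniteLocallyFree_serreTwist (jV R ≫ ιH) (D * D)))⁻¹ :=
    fun R => SerreTwist.cechPic_mk_eq_inv_detClass_serreTwist_of_forms (jV R ≫ ιH) (G R) (hGdeg R) hD (cY R) (i R) (hU R) (hg R)
  obtain ⟨tD, htD⟩ : m ∣ D * D := hmD.mul_right D
  -- graph data of `𝓜.univ` and of the slice triples
  let GrM : 𝓜.univ.A.X.left ⟶ 𝓜.univ.A.prodLeft 𝓜.univ.D.hat :=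
    pullback.lift (𝟙 _) 𝓜.univ.pol.lam.left (by rw [Category.id_comp, 𝓜.univ.pol.lam_comp_hom])
  have hGrM₁ : GrM ≫ pullback.fst 𝓜.univ.A.X.hom 𝓜.univ.D.hat.X.hom = 𝟙 _ := pullback.lift_fst _ _ _
  have hGrM₂ : GrM ≫ pullback.snd 𝓜.univ.A.X.hom 𝓜.univ.D.hat.X.hom = 𝓜.univ.pol.lam.left := pullback.lift_snd _ _ _
  let GrV : ∀ R, (𝓗.univ.baseChange (jV R)).A.X.left ⟶ (𝓗.univ.baseChange (jV R)).A.prodLeft (𝓗.univ.baseChange (jV R)).D.hat :=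
    fun R => pullback.lift (𝟙 _) (𝓗.univ.baseChange (jV R)).pol.lam.left
      (by rw [Category.id_comp, (𝓗.univ.baseChange (jV R)).pol.lam_comp_hom])
  have hGrV₁ : ∀ R, GrV R ≫ pullback.fst (𝓗.univ.baseChange (jV R)).A.X.hom (𝓗.univ.baseChange (jV R)).D.hat.X.hom = 𝟙 _ :=
    fun R => pullback.lift_fst _ _ _
  have hGrV₂ : ∀ R, GrV R ≫ pullback.snd (𝓗.univ.baseChange (jV R)).A.X.hom (𝓗.univ.baseChange (jV R)).D.hat.X.hom =
      (𝓗.univ.baseChange (jV R)).pol.lam.left := fun R => pullback.lift_snd _ _ _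
  -- the Plücker partner of `𝓜.univ` and the global line bundle `𝓝`
  let PiM : CechPic 𝓜.M.left :=
    (∏ j', detClass (𝓜.univ.isFiniteLocallyFree_pushforward_LDelta_tensorPow 𝓜.M.hom GrM hGrM₁ hGrM₂ (hk j')) ^ a j') *
      ∏ i', detClass (𝓜.univ.isFiniteLocallyFree_markedSectionPullback_LDelta GrM i') ^ c i'
  obtain ⟨c𝓝, hc𝓝⟩ := CechPic.mk_surjective (PiM ^ (-(tD : ℤ)))
  let IF : IFrames (Modules.lineBundle c𝓝) c𝓝.U := ⟨fun z => c𝓝.lineBundleFrame z⟩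
  -- the class computation `(j R)^*[𝓝] = [cY_R]`
  have hclass : ∀ R, detClass ((c𝓝.isFiniteLocallyFree_lineBundle).pullback (j R)) =
      detClass (cY R).isFiniteLocallyFree_lineBundle := fun R => by
    rw [detClass_pullback (j R) c𝓝.isFiniteLocallyFree_lineBundle, UnitCocycle.detClass_lineBundle,
      UnitCocycle.detClass_lineBundle, hc𝓝, hBz R, map_zpow]
    -- transport of the partner along the chart `j R` and along `V_R ↪ H`
    have h1 : CechPic.pullback (j R) PiM =
        (∏ j', detClass ((𝓗.univ.baseChange (jV R)).isFiniteLocallyFree_pushforward_LDelta_tensorPow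
            (jV R ≫ 𝓗.H.hom) (GrV R) (hGrV₁ R) (hGrV₂ R) (hk j')) ^ a j') *
          ∏ i', detClass ((𝓗.univ.baseChange (jV R)).isFiniteLocallyFree_markedSectionPullback_LDelta (GrV R) i') ^ c i' := by
      rw [← detClass_plucker_partner_of_isBaseChangeVia 𝓜.M.hom (hchart R) GrM hGrM₁ hGrM₂ (GrV R) (hGrV₁ R) (hGrV₂ R) hk a c]
    have h2 := detClass_plucker_partner_baseChange 𝓗.H.hom 𝓗.univ (jV R) Gr hGr₁ hGr₂ (GrV R) (hGrV₁ R) (hGrV₂ R) hk a c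
    have key : ∀ (e e' : ℕ), e = e' → detClass (SerreTwist.isFiniteLocallyFree_serreTwist (jV R ≫ ιH) e) =
        detClass (SerreTwist.isFiniteLocallyFree_serreTwist (jV R ≫ ιH) e') := by
      rintro e _ rfl; rfl
    rw [h1, h2, ← hPLeq, key (D * D) (m * tD) htD, SerreTwist.detClass_serreTwist_mul (jV R ≫ ιH) m tD,
      SerreTwist.detClass_serreTwist_comp (jV R) ιH m, zpow_neg, zpow_natCast]
  -- the module isomorphisms `(j R)^*𝓝 ≅ cY_R`
  have eφ : ∀ R, (Scheme.Modules.pullback (j R)).obj (Modules.lineBundle c𝓝) ≅ Modules.lineBundle (cY R) :=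
    fun R => ((nonempty_iso_iff_detClass_eq (hasRank_pullback (j R) c𝓝.hasRank_lineBundle) (cY R).hasRank_lineBundle
      ((c𝓝.isFiniteLocallyFree_lineBundle).pullback (j R)) (cY R).isFiniteLocallyFree_lineBundle).mpr (hclass R)).some
  -- assembly
  have hW' : ∀ R, ⨆ b, (j R) ⁻¹ᵁ c𝓝.U b = ⊤ := fun R => by
    rw [← Scheme.Hom.preimage_iSup]
    have : (⨆ b, c𝓝.U b) = ⊤ := by
      rw [eq_top_iff]; intro x _; exact Opens.mem_iSup.mpr ⟨x, c𝓝.mem x⟩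
    rw [this]; rfl
  have hqM : IsQuasiProjectiveOver 𝓜.M :=
    isQuasiProjectiveOver_of_framedPieces' (M := 𝓜.M) S IF _ j hG (fun R => Modules.lineBundle (cY R)) eφ t
      (fun R => (cY R).lineBundleFrameSystem) (fun _ _ => rfl) hW'
      (fun R c' => by rw [hloc R c']; exact haffG R c') (fun R => by simp_rw [hloc R]; exact hcovG R) hjcov
  exact ⟨hqM, 𝓜.isQuasiProjectiveOver_univ hδ hqM⟩

end SiegelFineModuliScheme

end Literature.AlgebraicGeometry.ModuliOfAbelianVarieties

end
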